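import Literature.Combinatorics.SimpleGraph.PfaffianBipartite
import Mathlib.GroupTheory.Perm.Sign
import HarnessLib

/-!
# Route PolyaContinued — support item `SignedCoverLittle` (stmt-ValiantsHypothesis-7426):
# no parallel row next to a degree-two row of a deletion-minimal non-Pfaffian graph

E-side lemma (SC3) for the chain `stub_chain` of the lead's line `even_induction`: the same-board
bicontraction ("fold") of a row `a` of degree two, with cells `(a, b₀), (a, b₁)`, transfers the
label identity only if NO OTHER ROW `r` sees both columns `b₀, b₁` (otherwise two perfect
matchings of the target would merge). This file shows that in a DELETION-MINIMAL non-Pfaffian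
`E ⊆ Fin n × Fin n` (every `E.erase e` Pfaffian) such a parallel row cannot exist:

* `isPolyaSigning_extend_parallel` — if row `a` has exactly the cells `(a, b₀), (a, b₁)` and
  `(r, b₀) ∈ E` (`r ≠ a`), a Pólya signing `s'` of `E.erase (r, b₁)` extends to a Pólya signing of
  `E` by `s (r, b₁) := - s' (a, b₁) s' (r, b₀) s' (a, b₀)`: the perfect matchings through
  `(r, b₁)` (which pass through `(a, b₀)`) pair off, by exchanging the columns `b₀, b₁`, with
  perfect matchings through `(a, b₁), (r, b₀)`, of opposite sign;
* `isPfaffianBipartite_of_erase_parallel`, `not_parallel_of_deletionMinimal` — hence `E` is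
  Pfaffian as soon as `E.erase (r, b₁)` is, and a deletion-minimal non-Pfaffian `E` has no row
  `r ≠ a` with both `(r, b₀), (r, b₁) ∈ E`.

Pure Pfaffian combinatorics (`IsPolyaSigning`, `PfaffianBipartite.lean`); no label identity here.
-/

namespace Summit.ValiantsHypothesis.PolyaContinued

open Finset Literature.Combinatorics.SimpleGraph Equiv

variable {n : ℕ}

/-- A product over `Fin n` with two factors pulled out. [folklore] -/
theorem prod_eq_mul_mul_prod_erase_erase {M : Type*} [CommMonoid M] (f : Fin n → M) {a r : Fin n}
    (har : a ≠ r) :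
    ∏ i, f i = f a * (f r * ∏ i ∈ (Finset.univ.erase a).erase r, f i) := by
  rw [← Finset.mul_prod_erase Finset.univ f (Finset.mem_univ a),
    ← Finset.mul_prod_erase (Finset.univ.erase a) f (Finset.mem_erase.2 ⟨har.symm, Finset.mem_univ r⟩)]

/-- **Extending a Pólya signing across a parallel cell.** Let row `a` of `E` consist of the cells
`(a, b₀), (a, b₁)` (`b₀ ≠ b₁`), let `r ≠ a` with `(r, b₀) ∈ E`, and let `s'` be a Pólya signing of
`E.erase (r, b₁)`. Then `s'`, changed at `(r, b₁)` to `- s' (a, b₁) s' (r, b₀) s' (a, b₀)`, is a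
Pólya signing of `E`. [folklore] -/
theorem isPolyaSigning_extend_parallel {E : Finset (Fin n × Fin n)} {a b₀ b₁ r : Fin n}
    (hb : b₀ ≠ b₁) (hrow : ∀ c, (a, c) ∈ E ↔ c = b₀ ∨ c = b₁) (hr : r ≠ a) (h₀ : (r, b₀) ∈ E)
    {s' : Fin n × Fin n → ℤˣ} (hs' : IsPolyaSigning (E.erase (r, b₁)) s') :
    IsPolyaSigning E fun e => if e = (r, b₁) then -(s' (a, b₁) * s' (r, b₀) * s' (a, b₀))
      else s' e := by
  classical
  intro σ hσ
  by_cases hσr : σ r = b₁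
  · -- a matching through `(r, b₁)`: it passes through `(a, b₀)`; exchange the columns `b₀, b₁`
    have hσa : σ a = b₀ := by
      rcases (hrow (σ a)).1 (hσ a) with h | h
      · exact h
      · exact absurd (σ.injective (h.trans hσr.symm)) hr.symm
    set τ : Perm (Fin n) := swap b₀ b₁ * σ with hτ
    have hτa : τ a = b₁ := by rw [hτ, Perm.mul_apply, hσa, swap_apply_left]
    have hτr : τ r = b₀ := by rw [hτ, Perm.mul_apply, hσr, swap_apply_right]
    have hτi : ∀ i, i ≠ a → i ≠ r → τ i = σ i := by
      intro i hia hir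
      rw [hτ, Perm.mul_apply]
      refine swap_apply_of_ne_of_ne ?_ ?_
      · intro h; exact hia (σ.injective (h.trans hσa.symm))
      · intro h; exact hir (σ.injective (h.trans hσr.symm))
    have hτE : ∀ i, (i, τ i) ∈ E.erase (r, b₁) := by
      intro i
      rw [Finset.mem_erase]
      by_cases hia : i = a
      · subst hia
        rw [hτa]
        exact ⟨fun h => hr.symm (Prod.ext_iff.1 h).1, (hrow b₁).2 (Or.inr rfl)⟩
      by_cases hir : i = r
      · subst hir
        rw [hτr]
        exact ⟨fun h => hb (Prod.ext_iff.1 h).2, h₀⟩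
      · rw [hτi i hia hir]
        exact ⟨fun h => hir (Prod.ext_iff.1 h).1, hσ i⟩
    have hpol := hs' τ hτE
    have hsign : Perm.sign τ = -Perm.sign σ := by
      rw [hτ, Perm.sign_mul, Perm.sign_swap hb, neg_one_mul]
    -- compare the two sign products factor by factor
    rw [prod_eq_mul_mul_prod_erase_erase _ hr.symm] at hpol ⊢
    have hrest : ∏ i ∈ (Finset.univ.erase a).erase r,
        (if (i, σ i) = (r, b₁) then -(s' (a, b₁) * s' (r, b₀) * s' (a, b₀)) else s' (i, σ i)) =
        ∏ i ∈ (Finset.univ.erase a).erase r, s' (i, τ i) := by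
      refine Finset.prod_congr rfl fun i hi => ?_
      have hir : i ≠ r := Finset.ne_of_mem_erase hi
      have hia : i ≠ a := Finset.ne_of_mem_erase (Finset.mem_of_mem_erase hi)
      rw [if_neg fun h => hir (Prod.ext_iff.1 h).1, hτi i hia hir]
    rw [hrest, hσa, hσr]
    dsimp only
    rw [if_neg fun h => hr.symm (Prod.ext_iff.1 h).1, if_pos rfl]
    rw [hτa, hτr, hsign] at hpol
    -- `sign σ * (s₀ * (-(s₁ s₂ s₀) * R)) = -sign σ * (s₁ * (s₂ * R))` since `s₀ s₀ = 1`
    apply Units.ext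
    have h2 : ((s' (a, b₀) : ℤˣ) : ℤ) * s' (a, b₀) = 1 := by
      rw [← Units.val_mul, Int.units_mul_self, Units.val_one]
    have hpol' := congrArg Units.val hpol
    push_cast at hpol' ⊢
    linear_combination (((s' (a, b₀) : ℤˣ) : ℤ) * s' (a, b₀)) * hpol' + h2
  · -- a matching avoiding `(r, b₁)` is a matching of `E.erase (r, b₁)`, with the same signs
    have hσE : ∀ i, (i, σ i) ∈ E.erase (r, b₁) := by
      intro i
      rw [Finset.mem_erase]
      refine ⟨fun h => ?_, hσ i⟩
      obtain ⟨hi, hσi⟩ := Prod.ext_iff.1 h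
      simp only at hi hσi
      subst hi
      exact hσr hσi
    have hpol := hs' σ hσE
    have hprod : ∏ i, (if (i, σ i) = (r, b₁) then -(s' (a, b₁) * s' (r, b₀) * s' (a, b₀))
        else s' (i, σ i)) = ∏ i, s' (i, σ i) := by
      refine Finset.prod_congr rfl fun i _ => ?_
      rw [if_neg]
      intro h
      obtain ⟨hi, hσi⟩ := Prod.ext_iff.1 h
      simp only at hi hσi
      subst hi
      exact hσr hσi
    rw [hprod]
    exact hpol

/-- **A parallel cell next to a degree-two row is removable**: if row `a` of `E` is
`{(a, b₀), (a, b₁)}`, `r ≠ a`, `(r, b₀) ∈ E`, and `E.erase (r, b₁)` is Pfaffian, then `E` is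
Pfaffian. [folklore] -/
theorem isPfaffianBipartite_of_erase_parallel {E : Finset (Fin n × Fin n)} {a b₀ b₁ r : Fin n}
    (hb : b₀ ≠ b₁) (hrow : ∀ c, (a, c) ∈ E ↔ c = b₀ ∨ c = b₁) (hr : r ≠ a) (h₀ : (r, b₀) ∈ E)
    (h : IsPfaffianBipartite (E.erase (r, b₁))) : IsPfaffianBipartite E := by
  obtain ⟨s', hs'⟩ := h
  exact ⟨_, isPolyaSigning_extend_parallel hb hrow hr h₀ hs'⟩

/-- **No parallel row in a deletion-minimal non-Pfaffian graph.** If `E` is not Pfaffian but every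
`E.erase e` (`e ∈ E`) is, and row `a` is `{(a, b₀), (a, b₁)}` with `b₀ ≠ b₁`, then no row `r ≠ a`
contains both `(r, b₀)` and `(r, b₁)`. [folklore] -/
theorem not_parallel_of_deletionMinimal {E : Finset (Fin n × Fin n)} (hE : ¬ IsPfaffianBipartite E)
    (hdel : ∀ e ∈ E, IsPfaffianBipartite (E.erase e)) {a b₀ b₁ : Fin n} (hb : b₀ ≠ b₁)
    (hrow : ∀ c, (a, c) ∈ E ↔ c = b₀ ∨ c = b₁) {r : Fin n} (hr : r ≠ a) (h₀ : (r, b₀) ∈ E)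
    (h₁ : (r, b₁) ∈ E) : False :=
  hE (isPfaffianBipartite_of_erase_parallel hb hrow hr h₀ (hdel _ h₁))

end Summit.ValiantsHypothesis.PolyaContinued
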